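import Mathlib
import Summits.CriticalPhenomena.Ising3DConformalLimit.Theses.PrecisionLaplacian
import Literature.Probability.LatticeModels.AxisSpectralRepresentation

/-!
# Sketch — crux-ideate for `DirectCorrelationStableTail` (item stmt-CriticalPhenomena-4799)

First lemmas of the idea cards (statements only; they must elaborate, not be proved):

* card `stieltjes-inversion-cm-direct-correlation` → `AxialCompleteMonotonicity`
* card `flight-diffusivity-dichotomy-unitarity` → `DiffusiveBranchCoulomb` (+ the proved
  bookkeeping `coulomb_gives_twoPointLaw`: the diffusive branch delivers the antecedent of
  `MoebiusLimitOfTwoPointLaw` with `2Δ = 1`).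

`hyp_iff` checks that the abbreviations below restate the crux verbatim.
-/

noncomputable section

namespace Summit.CriticalPhenomena.Ising3DConformalLimit.Cruxes.DirectCorrelationStableTail

open MeasureTheory Filter
open Literature.Probability.LatticeModels
open Summit.CriticalPhenomena.Ising3DConformalLimit.Theses.PrecisionLaplacian

/-- The critical kernel `G_A = (⟨σ_p σ_q⟩_{β_c(3)})_{p,q ∈ A}` on a finite set of sites. -/
abbrev GA (A : Finset (Site 3)) : Matrix ↥A ↥A ℝ :=
  Matrix.of fun (p q : ↥A) => criticalTwoPoint 3 (q.1 - p.1)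

/-- The symmetric-potential hypothesis of the crux (= conclusion of support `InverseMCriticalKernel`). -/
def SymmPotential : Prop :=
  ∀ A : Finset (Site 3), (GA A).PosDef ∧
    ∀ u v : ↥A, (u ≠ v → (GA A)⁻¹ u v ≤ 0) ∧ 0 ≤ ∑ w, (GA A)⁻¹ u w

/-- The direct correlation function `a(x) = inf_{A ∋ 0,x} −(G_A⁻¹)(0,x)`. -/
def dcf (x : Site 3) : ℝ :=
  ⨅ A : {A : Finset (Site 3) // (0 : Site 3) ∈ A ∧ x ∈ A}, -((GA A.1)⁻¹ ⟨0, A.2.1⟩ ⟨x, A.2.2⟩)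

/-- The conclusion TAIL of the crux. -/
def TailConclusion : Prop :=
  ∃ (η : ℝ) (Φ : (Fin 3 → ℝ) → ℝ), 0 < η ∧ η < 1 ∧ ContinuousOn Φ {u | ∑ i, u i ^ 2 = 1} ∧
    (∀ u : Fin 3 → ℝ, ∑ i, u i ^ 2 = 1 → 0 ≤ Φ u) ∧ (∃ u : Fin 3 → ℝ, ∑ i, u i ^ 2 = 1 ∧ 0 < Φ u) ∧
    Tendsto (fun x : Site 3 => dcf x * Real.sqrt (∑ j, ((x j : ℝ)) ^ 2) ^ (5 - η)
      - Φ (fun i => (x i : ℝ) / Real.sqrt (∑ j, ((x j : ℝ)) ^ 2))) cofinite (nhds 0)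

/-- Faithfulness check: the crux is literally `SymmPotential → TailConclusion`. -/
theorem hyp_iff : DirectCorrelationStableTail ↔ (SymmPotential → TailConclusion) := Iff.rfl

/-! ## Card A — Stieltjes ⇒ complete-Bernstein inversion per transverse momentum -/

/-- **First lemma of card A (axial complete monotonicity of the direct correlation function).**
Under the symmetric-potential hypothesis, along every coordinate axis the direct correlation
function beyond the nearest neighbour is a Hausdorff moment sequence: there is a finite positive
measure `m` on `[0,1)` with `a(n eᵢ) = ∫ t^{n-2} dm(t)` for all `n ≥ 2`. (Mechanism: the
transfer-matrix spectral representation `AizenmanDuminilCopin2021_prop_8_6` for general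
finitely supported `v` makes `s ↦ Ĝ(s, p)` a Stieltjes function of `s = 2 − 2cos k₁` for a.e.
transverse momentum `p`; its reciprocal `ψ(·,p)` is complete Bernstein; the `k₁`-Fourier
coefficients of `−ψ(·,p)` for `|n| ≥ 2` are `∫ t ρ(t)^{|n|} (t²+4t)^{-1/2} σ_p(dt) ≥ 0`,
`ρ(t) = 1 + t/2 − √(t + t²/4) ∈ (0,1)`; integrate over `p`.) -/
def AxialCompleteMonotonicity : Prop :=
  SymmPotential → ∀ i : Fin 3, ∃ m : Measure ℝ, IsFiniteMeasure m ∧ m (Set.Ico (0 : ℝ) 1)ᶜ = 0 ∧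
    ∀ n : ℕ, 2 ≤ n → dcf (Pi.single i (n : ℤ)) = ∫ t, t ^ (n - 2) ∂m

/-- The same along the six face diagonals `eᵢ ± eⱼ` (2×2 matrix-valued complete Bernstein
functions for the two cosets of the plane lattice `{xᵢ = ±xⱼ}`; steps of `ℓ = xᵢ ∓ xⱼ` by 2). -/
def FaceDiagonalCompleteMonotonicity : Prop :=
  SymmPotential → ∀ i j : Fin 3, i ≠ j → ∀ ε : ℤ, (ε = 1 ∨ ε = -1) →
    ∃ m : Measure ℝ, IsFiniteMeasure m ∧ m (Set.Ico (0 : ℝ) 1)ᶜ = 0 ∧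
      ∀ n : ℕ, 2 ≤ n → dcf (Pi.single i (n : ℤ) + Pi.single j (ε * n)) = ∫ t, t ^ (n - 2) ∂m

/-! ## Card B — diffusivity dichotomy of the direct-correlation flight -/

/-- **First lemma of card B (the diffusive branch proves the isotropic Coulomb law).** If the direct
correlation function has a finite second moment (`Z := 6 / ∑ a(x)|x|² > 0`, the flight is in the
Gaussian domain of attraction), then by Spitzer's P26.1 (genuinely three-dimensional aperiodic walk,
mean zero, finite second moments) and cubic symmetry, `⟨σ₀σ_x⟩_{β_c(3)} · |x|₂ → c > 0`: item 0634
with `2Δ = 1`. -/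
def DiffusiveBranchCoulomb : Prop :=
  SymmPotential → Summable (fun x : Site 3 => dcf x * ∑ j, ((x j : ℝ)) ^ 2) →
    ∃ c : ℝ, 0 < c ∧
      Tendsto (fun x : Site 3 => criticalTwoPoint 3 x * Real.sqrt (∑ j, ((x j : ℝ)) ^ 2))
        cofinite (nhds c)

/-- Bookkeeping (proved): the Coulomb law is the antecedent of the imported crux
`MoebiusLimitOfTwoPointLaw` (item 0634's form) with `Δ = 1/2`. -/
theorem coulomb_gives_twoPointLaw
    (h : ∃ c : ℝ, 0 < c ∧
      Tendsto (fun x : Site 3 => criticalTwoPoint 3 x * Real.sqrt (∑ j, ((x j : ℝ)) ^ 2))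
        cofinite (nhds c)) :
    ∃ Δ c : ℝ, 0 < c ∧ Tendsto (fun x : Site 3 =>
      criticalTwoPoint 3 x * Real.sqrt (∑ i, ((x i : ℝ)) ^ 2) ^ (2 * Δ)) cofinite (nhds c) := by
  obtain ⟨c, hc, ht⟩ := h
  refine ⟨1 / 2, c, hc, ?_⟩
  have h1 : (2 : ℝ) * (1 / 2) = 1 := by norm_num
  simp only [h1, Real.rpow_one]
  exact ht

/-- The superdiffusive branch forced by the crux: TAIL implies `∑ a(x)|x|² = ∞` (`Z = 0`), so any
proof of the crux must exclude the diffusive branch; card B does it through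
`MoebiusLimitOfTwoPointLaw`, `IsingEuclidUpgradeR4NonGaussian` and free-field rigidity at the
unitarity bound `Δ = (d−2)/2`. Typed form of the exclusion target: -/
def DiffusiveBranchExcluded : Prop :=
  SymmPotential → MoebiusLimitOfTwoPointLaw → IsingEuclidUpgradeR4NonGaussian →
    ¬ Summable (fun x : Site 3 => dcf x * ∑ j, ((x j : ℝ)) ^ 2)

/-- Free-field rigidity at the unitarity bound (Jost–Schroer–Pohlmeyer, Euclidean/Möbius form):
a Möbius-covariant pointwise scaling limit of the critical correlators with weight `Δ = 1/2`
(forced when its two-point function is the Coulomb kernel) has vanishing connected four-point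
function. This is the one stub card B adds to the route's imported cruxes. -/
def UnitarityBoundRigidity : Prop :=
  ∀ (ρ : ℝ → ℝ) (S : CorrFamily 3), (∀ δ ∈ Set.Ioc (0:ℝ) 1, 0 < ρ δ) →
    HasPointwiseScalingLimit (criticalCorr 3) ρ S → IsMoebiusCovariant (1/2 : ℝ) S →
      ¬ HasNontrivialU4 S

/-- Card B's line in one implication (all names above): the two imported cruxes of the route plus
unitarity-bound rigidity exclude the diffusive branch. Proof sketch (not formalised here):
`DiffusiveBranchCoulomb` + `coulomb_gives_twoPointLaw` feed `MoebiusLimitOfTwoPointLaw`, whose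
limit `S` has `Δ = 1/2` by non-degeneracy; `IsingEuclidUpgradeR4NonGaussian` gives
`HasNontrivialU4 S`, contradicting `UnitarityBoundRigidity`. -/
def CardBLine : Prop :=
  DiffusiveBranchCoulomb → UnitarityBoundRigidity → DiffusiveBranchExcluded

end Summit.CriticalPhenomena.Ising3DConformalLimit.Cruxes.DirectCorrelationStableTail
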